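import Summits.QuantumFields.BalabanUV.Beta.SymSliceBlockMatrix

/-!
# `BalabanUV.Beta.SymSliceProjectorKernel` — binder row D1, JSB12SYM-SPINE v1.1 (Σ3) step K1-b part 2: KERNEL VECTORS OF `Gmat` ARE GAUGE-FIXED FORMS
# (so `Π^{sym}_bm` fixes them — rule (R34) at block level) and THE SLICE PROJECTOR KERNEL `symEc ρ_c N` (field block: the block-orthogonal projector
# `Pmat` translated to every block, identity on face-crossing bonds; multiplier block: the coarse indicator, as `axEc`), symmetric with a block window

CHART (RULING R-D1-g25-4): chart (II) — the FIXED κ = 0 slice `ker G_sym`; the slice-exchange row hSX is a separate binder, not in this file.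
HONEST FRAMING (cell contract, verbatim): «discharging `BetaPertH` makes Bałaban's UV stability UNCONDITIONAL — a real constructive-QFT
result; it is NOT the continuum limit and NOT the Clay problem.»  THIS MODULE DISCHARGES NOTHING of `BetaPertH` ∕ row D1: [folklore] finite linear
algebra + kernel bookkeeping of OUR objects.  0 sorry, 0 `def … : Prop`, nothing cited.  NOT HERE (K1-b part 3 ∕ K2): `Spr symEc`, its `permK`∕`refK`
covariance, the `comp` identities `symEc ∘ Π̂ᵀ_sym = Π̂ᵀ_sym` ∕ `Π̂_sym ∘ symEc = symEc` at kernel level (their block-level content is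
`SymSliceBlockMatrix.Pmat_mulVec_restrictV` and `symAxProjBmAt_kernelForm` below), and `RelInvBorderedHessian`'s four rules for `coDressKSymAt`.
NOT D1, NOT BetaPertH, NOT continuum, NOT Clay.
HONEST DEPENDENCY (verbatim): «continuum YM on T⁴ ⇐ BetaPertH ∧ nine spine estimates (0/9 proved); BetaPertH ⇐ (D1) ∧ (D4) ∧ CAP+tail;
G-an2-4 gates asym, D1 and NE2/3/4.»  ABSOLUTE RULE (cell, verbatim): «No internally-minted statement may enter as a cited fact. Every
hypothesis is either kernel-proved in this package or a verbatim quotation of a PUBLISHED theorem with page reference.»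
Unit `b2b-balaban-beta-an2` gen 25 (row-D1 owner), 2026-08-21.
-/

namespace Summit.QuantumFields.BalabanUV.Beta.SymSliceProjectorKernel

noncomputable section

open Finset Matrix
open scoped BigOperators Nat
open Literature.MathematicalPhysics.QuantumFieldTheory
open Literature.MathematicalPhysics.QuantumFieldTheory.Balaban1983to89
open Literature.MathematicalPhysics.QuantumFieldTheory.Balaban1983to89.Beta
open Literature.Probability.LatticeModels (Torus.proj)
open ExpKernelCalculus (MKer)
open AffineAveraging (Form0 Form1 Site unitVec unitVec_apply box toSite blockSum)
open AveragingContours (blk grad shift blk_block off off_mem_box blk_add_off)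
open AveragingContoursRooted (ctr ctrOff ctrOff_mem_box)
open OneStepResolventKernel (Fib)
open Summit.QuantumFields.BalabanUV.Beta.TameKernelCalculus (trK)
open Summit.QuantumFields.BalabanUV.Beta.AxialDressingRooted (cube mem_cube)
open Summit.QuantumFields.BalabanUV.Beta.SymmetrisedAxialPotential
open Summit.QuantumFields.BalabanUV.Beta.SymmetrisedAxialGauge
open Summit.QuantumFields.BalabanUV.Beta.SymmetrisedAxialGaugeBlockMean
open Summit.QuantumFields.BalabanUV.Beta.SymmetrisedDressingMatrix
open Summit.QuantumFields.BalabanUV.Beta.KernelOrthoProjector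
open Summit.QuantumFields.BalabanUV.Beta.SymSliceBlockMatrix

variable {n : ℕ}

/-! ## §1 Kernel vectors of `Gmat` are gauge-fixed forms -/

/-- [folklore] The offset of a block-`0` point is itself. -/
theorem off_toSite {N : ℕ} (hN : 1 ≤ N) {b : Fin n → ℕ} (hb : b ∈ box n N) : off N (toSite b) = b := by
  have h := blk_add_off hN (toSite b)
  rw [blk_toSite hb, smul_zero, zero_add] at h
  exact toSite_inj.1 h

/-- [our object] **THE FORM OF A BLOCK VECTOR**: the one-form supported on the interior bonds of block `0` with the values `v`. -/
def kernelForm (N : ℕ) (v : BIdx n N → ℝ) : Form1 n ℝ := fun κ w =>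
  if h : (κ, off N w) ∈ bIdxSet n N ∧ blk N w = 0 then v ⟨(κ, off N w), h.1⟩ else 0

/-- [folklore] On an interior bond of block `0` the form reads the vector. -/
theorem kernelForm_apply_bIdx {N : ℕ} (hN : 1 ≤ N) (v : BIdx n N → ℝ) (j : BIdx n N) : kernelForm N v j.1.1 (toSite j.1.2) = v j := by
  have hb : j.1.2 ∈ box n N := (mem_bIdxSet.1 j.2).1
  have hoff : off N (toSite j.1.2) = j.1.2 := off_toSite hN hb
  have hmem : (j.1.1, off N (toSite j.1.2)) ∈ bIdxSet n N := by rw [hoff]; exact j.2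
  unfold kernelForm
  rw [dif_pos ⟨hmem, blk_toSite hb⟩]
  congr 1
  apply Subtype.ext
  simp only [hoff]

/-- [folklore] Outside block `0` the form vanishes. -/
theorem kernelForm_of_blk_ne {N : ℕ} (v : BIdx n N → ℝ) {κ : Fin n} {w : Site n} (hw : blk N w ≠ 0) : kernelForm N v κ w = 0 := by
  unfold kernelForm
  rw [dif_neg]
  exact fun h => hw h.2

/-- [folklore] **A KERNEL VECTOR OF `Gmat` DEFINES A GAUGE-FIXED FORM**: `Gmat N *ᵥ v = 0 → SymAxialGaugeAt ρ_c (kernelForm N v) N` (`N ≥ 1`). -/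
theorem symAxialGaugeAt_kernelForm {N : ℕ} (hN : 1 ≤ N) {v : BIdx n N → ℝ} (hv : Gmat N *ᵥ v = 0) :
    SymAxialGaugeAt (ctr n N) (kernelForm N v) N := by
  intro y b hb
  -- rewrite the gauge integral as the symmetrised tree gauge at the point
  have hpt : symAxial (kernelForm N v) ((N : ℤ) • y + ctr n N) ((N : ℤ) • y + toSite b)
      = symTreeGaugeAt (ctr n N) (kernelForm N v) N ((N : ℤ) • y + toSite b) := by
    rw [symTreeGaugeAt, blk_block y hb]
  rw [hpt]
  by_cases hy : y = 0
  · subst hy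
    rw [smul_zero, zero_add]
    by_cases hbr : b = ctrOff n N
    · subst hbr
      rw [symTreeGaugeAt, blk_toSite hb, smul_zero, zero_add]
      exact symAxial_self _ _
    · have hz : b ∈ cIdxSet n N := Finset.mem_erase.2 ⟨hbr, hb⟩
      rw [symTreeGaugeAt_expand hN _ (blk_toSite hb)]
      have h0 := congrFun hv ⟨b, hz⟩
      rw [Matrix.mulVec, Pi.zero_apply] at h0
      rw [← h0]
      refine Finset.sum_congr rfl fun j _ => ?_
      rw [kernelForm_apply_bIdx hN]
      simp only [Gmat]
      ring
  · rw [show ctr n N = toSite (ctrOff n N) from rfl]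
    rw [symTreeGaugeAt_congr hN (ctrOff_mem_box hN) (A' := (0 : Form1 n ℝ))]
    · exact symTreeGaugeAt_zero _ _ _
    · intro κ z hz _
      rw [blk_block y hb] at hz
      rw [Pi.zero_apply, Pi.zero_apply]
      exact kernelForm_of_blk_ne v (by rw [hz]; exact hy)

/-- [folklore] **`Π^{sym}_bm` FIXES THE FORMS OF KERNEL VECTORS** (rule (R34) at block level; S1f `symAxProjBmAt_eq_self_of_symAxialGaugeAt`). -/
theorem symAxProjBmAt_kernelForm {N : ℕ} (hN : 1 ≤ N) {v : BIdx n N → ℝ} (hv : Gmat N *ᵥ v = 0) :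
    symAxProjBmAt (ctr n N) N (kernelForm N v) = kernelForm N v :=
  symAxProjBmAt_eq_self_of_symAxialGaugeAt hN (symAxialGaugeAt_kernelForm hN hv)

/-- [folklore] In particular for the columns of `Pmat` (`Gmat·Pmat = 0`, K1-b core `mul_kerProj`). -/
theorem symAxProjBmAt_kernelForm_Pmat {N : ℕ} (hN : 1 ≤ N) (w : BIdx n N → ℝ) :
    symAxProjBmAt (ctr n N) N (kernelForm N (Pmat N *ᵥ w)) = kernelForm N (Pmat N *ᵥ w) :=
  symAxProjBmAt_kernelForm hN (by rw [Pmat, mulVec_kerProj (isUnit_det_gram_Gmat hN)])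

/-! ## §2 The slice projector kernel `symEc` -/

section Kernel

variable {d : ℕ}

/-- [folklore] [our object] «the bond `(α, x)` is INTERIOR to its block»: `(α, off N x) ∈ bIdxSet`. -/
def IsIntBond (N : ℕ) (α : Fin (d + 1)) (x : Fin (d + 1) → ℤ) : Prop := (α, off N x) ∈ bIdxSet (d + 1) N

/-- [folklore] `IsIntBond N α x` is decidable (membership in a finite set). -/
instance instDecIsIntBond (N : ℕ) (α : Fin (d + 1)) (x : Fin (d + 1) → ℤ) : Decidable (IsIntBond N α x) := by
  unfold IsIntBond; infer_instance

/-- [our object] **THE SLICE PROJECTOR KERNEL** `symEc N` (centred root, chart (II)): on the field block, for two interior bonds of the SAME block the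
entry of the block-orthogonal projector `Pmat N` at their offsets; for a face-crossing bond the identity; otherwise `0`; on the multiplier block the
coarse indicator `[x = x′ ∧ m = m′ ∧ proj N x = 0]` (as `AxialCoordinateProjectorCoarse.axEc`); mixed blocks `0`. -/
def symEc (N : ℕ) : MKer (d + 1) (Fib d) := fun x x' a b =>
  match a, b with
  | Sum.inl α, Sum.inl β =>
      if h : IsIntBond N α x ∧ IsIntBond N β x' then
        (if blk N x = blk N x' then Pmat N ⟨(α, off N x), h.1⟩ ⟨(β, off N x'), h.2⟩ else 0)
      else (if x = x' ∧ α = β then 1 else 0)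
  | Sum.inl _, Sum.inr _ => 0
  | Sum.inr _, Sum.inl _ => 0
  | Sum.inr m, Sum.inr m' => if x = x' ∧ m = m' ∧ Torus.proj N x = 0 then 1 else 0

/-- [folklore] Field–multiplier entry vanishes. -/
theorem symEc_inl_inr (N : ℕ) (x x' : Fin (d + 1) → ℤ) (α m : Fin (d + 1)) : symEc N x x' (Sum.inl α) (Sum.inr m) = 0 := rfl

/-- [folklore] Multiplier–field entry vanishes. -/
theorem symEc_inr_inl (N : ℕ) (x x' : Fin (d + 1) → ℤ) (m α : Fin (d + 1)) : symEc N x x' (Sum.inr m) (Sum.inl α) = 0 := rfl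

/-- [folklore] Multiplier–multiplier entry: the coarse indicator. -/
theorem symEc_inr_inr (N : ℕ) (x x' : Fin (d + 1) → ℤ) (m m' : Fin (d + 1)) :
    symEc N x x' (Sum.inr m) (Sum.inr m') = if x = x' ∧ m = m' ∧ Torus.proj N x = 0 then 1 else 0 := rfl

/-- [folklore] Field–field entry, both bonds interior. -/
theorem symEc_inl_inl_of_int {N : ℕ} {x x' : Fin (d + 1) → ℤ} {α β : Fin (d + 1)} (hx : IsIntBond N α x) (hx' : IsIntBond N β x') :
    symEc N x x' (Sum.inl α) (Sum.inl β)
      = if blk N x = blk N x' then Pmat N ⟨(α, off N x), hx⟩ ⟨(β, off N x'), hx'⟩ else 0 := by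
  show (if h : IsIntBond N α x ∧ IsIntBond N β x' then _ else _) = _
  rw [dif_pos ⟨hx, hx'⟩]

/-- [folklore] Field–field entry, not both interior: the identity. -/
theorem symEc_inl_inl_of_not_int {N : ℕ} {x x' : Fin (d + 1) → ℤ} {α β : Fin (d + 1)} (h : ¬ (IsIntBond N α x ∧ IsIntBond N β x')) :
    symEc N x x' (Sum.inl α) (Sum.inl β) = if x = x' ∧ α = β then 1 else 0 := by
  show (if h : IsIntBond N α x ∧ IsIntBond N β x' then _ else _) = _
  rw [dif_neg h]

/-- [folklore] **`symEc` IS SYMMETRIC**: `trK (symEc N) = symEc N` (`Pmat` is symmetric: `kerProj_transpose`). -/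
theorem trK_symEc (N : ℕ) : trK (symEc (d := d) N) = symEc N := by
  funext x x' a b
  show symEc N x' x b a = symEc N x x' a b
  rcases a with α | m <;> rcases b with β | m'
  · by_cases h : IsIntBond N α x ∧ IsIntBond N β x'
    · rw [symEc_inl_inl_of_int h.2 h.1, symEc_inl_inl_of_int h.1 h.2]
      by_cases hb : blk N x = blk N x'
      · rw [if_pos hb.symm, if_pos hb, Pmat, ← kerProj_transpose (Gmat N), Matrix.transpose_apply, kerProj_transpose]
      · rw [if_neg (Ne.symm hb), if_neg hb]
    · rw [symEc_inl_inl_of_not_int (fun h' => h ⟨h'.2, h'.1⟩), symEc_inl_inl_of_not_int h]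
      by_cases he : x = x' ∧ α = β
      · obtain ⟨rfl, rfl⟩ := he; rfl
      · rw [if_neg (fun h' => he ⟨h'.1.symm, h'.2.symm⟩), if_neg he]
  · rfl
  · rfl
  · rw [symEc_inr_inr, symEc_inr_inr]
    by_cases he : x = x' ∧ m = m' ∧ Torus.proj N x = 0
    · obtain ⟨rfl, rfl, hp⟩ := he; rfl
    · rw [if_neg he, if_neg]
      rintro ⟨rfl, rfl, hp⟩
      exact he ⟨rfl, rfl, hp⟩

/-- [folklore] **THE BLOCK WINDOW**: a non-zero field–field entry has both points in one block or coincident, hence `x′ − x ∈ cube`. -/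
theorem symEc_inl_inl_window {N : ℕ} (hN : 1 ≤ N) {x x' : Fin (d + 1) → ℤ} {α β : Fin (d + 1)} (h : symEc N x x' (Sum.inl α) (Sum.inl β) ≠ 0) :
    x' - x ∈ cube (d + 1) N := by
  by_cases hi : IsIntBond N α x ∧ IsIntBond N β x'
  · rw [symEc_inl_inl_of_int hi.1 hi.2] at h
    by_cases hb : blk N x = blk N x'
    · exact sub_mem_cube_of_blk_eq hN hb
    · exact absurd (if_neg hb) (fun e => h (by rw [e]))
  · rw [symEc_inl_inl_of_not_int hi] at h
    by_cases he : x = x' ∧ α = β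
    · rw [he.1, sub_self]; exact AxialDressingRooted.zero_mem_cube N
    · exact absurd (if_neg he) (fun e => h (by rw [e]))

end Kernel

end

end Summit.QuantumFields.BalabanUV.Beta.SymSliceProjectorKernel
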